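import Summits.NavierStokesRegularity.FunctionalMining.TopEigSimpleGap
import Summits.NavierStokesRegularity.FunctionalMining.TopEigDensityFrame
import HarnessLib

/-!
# FunctionalMining — SIEVELD's density (1) VERBATIM at a point of the simple set: the channels of
# `Δλ₁` in Mathlib's orthonormal eigenbasis of `S(v)(x)`, with denominators `λ₁ − λ_a`
# (F1 PART I Prop. 3 / Lemma 10 (e), no eigenpair input)

Search for candidate a priori estimates; no regularity claim. Cell `pub-nsfunc`, prove seat
(gen 23). `TopEigDensityLocal*` give `Δλ₁(x) = eᵀS(Δv)(x)e + 2∑ₖN′ₖᵀS(∂ₖv)(x)e` at a simple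
point with the channels in INVERSE-FREE form `N′ₖᵀS(∂ₖv)e = λ|N′ₖ|² − N′ₖᵀS(x)N′ₖ ≥ 0`;
`TopEigDensityFrame` (gen 22) identifies such a channel, along a line, with the R-form
`∑_{a≠a₀}(u_aᵀA′e)²/(μ − κ_a)` in a complete orthonormal eigenframe. Here the two are assembled at a
point `x ∈ U_s = {λ₂ < λ₁}` of the strain of a smooth field on `T³`, the frame being Mathlib's
`(torusStrainMatrix_isHermitian v x).eigenvectorBasis` with eigenvalues `κ = ….eigenvalues`:

* `TopEig.exists_eigenvalues_eq_topEig` — some basis index `a₀` carries `κ a₀ = λ₁(x)`;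
  `TopEig.eigenvalues_le_midEig_of_ne` — for `a ≠ a₀`, `κ a ≤ λ₂(x)` (so `λ₁ − κ_a ≥ λ₁ − λ₂ > 0`);
  `TopEig.gapForm_eigenvectorBasis` — the gap form at `u_{a₀}` with gap `λ₁ − λ₂`;
* **`TopEig.partialDeriv_partialDeriv_torusStrainTopEig_eq_sum_frame`** —
  `∂ₖλ₁(x) = u₀ᵀS(∂ₖv)(x)u₀` and
  `∂ₖ∂ₖλ₁(x) = u₀ᵀS(∂ₖ∂ₖv)(x)u₀ + 2∑_{a≠a₀}(u_aᵀS(∂ₖv)(x)u₀)²/(λ₁(x) − κ_a)` (`u₀ := u_{a₀}`);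
* **`TopEig.laplacian_torusStrainTopEig_eq_sum_frame`** —
  `Δλ₁(x) = u₀ᵀS(Δv)(x)u₀ + 2∑ₖ∑_{a≠a₀}(u_aᵀS(∂ₖv)(x)u₀)²/(λ₁(x) − κ_a)`: the rotation and tilt channels
  of SIEVELD §3.4b (1) / F1 PART I (1) verbatim (`⟨e_a, ∂ₖS e₁⟩²/(λ₁ − λ_a)`), at every point of `U_s`,
  for `λ₁` ITSELF, with nothing assumed beyond `v` smooth and `λ₂(x) < λ₁(x)`.

[ours; F1 PART I Prop. 3, Lemma 10 (e)]
-/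

noncomputable section

open Filter Topology Matrix Finset
open scoped ContDiff

namespace Summit.NavierStokesRegularity.FunctionalMining

open Literature.Analysis Literature.Analysis.FunctionSpaces Literature.Analysis.FunctionSpaces.Torus
  SharpClass.DirectorForm Literature.Analysis.Matrix

namespace TopEig

variable {v : UnitAddTorus (Fin 3) → EuclideanSpace ℝ (Fin 3)}

/-- `2 ≤ card (Fin 3)` (private: the statement exists elsewhere in the tree). [folklore] -/
private theorem two_le_card_fin_three' : 2 ≤ Fintype.card (Fin 3) := by simp

/-! ## 1. The eigenbasis at a point of `U_s`: the top index, the other eigenvalues, the gap form -/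

/-- **Some vector of Mathlib's orthonormal eigenbasis of `S(v)(x)` carries the eigenvalue `λ₁(x)`.**
[folklore] -/
theorem exists_eigenvalues_eq_topEig (v : UnitAddTorus (Fin 3) → EuclideanSpace ℝ (Fin 3))
    (x : UnitAddTorus (Fin 3)) :
    ∃ a₀ : Fin 3, (torusStrainMatrix_isHermitian v x).eigenvalues a₀ = torusStrainTopEig v x := by
  set hS := torusStrainMatrix_isHermitian v x
  let e3 : Fin (Fintype.card (Fin 3)) ≃ Fin 3 := Fintype.equivOfCardEq (Fintype.card_fin _)
  have he : ∀ j, hS.eigenvalues (e3 j) = hS.eigenvalues₀ j := fun j => by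
    simp [Matrix.IsHermitian.eigenvalues, e3]
  refine ⟨e3 (Fin.castLE two_le_card_fin_three' 0), ?_⟩
  rw [he, (torusStrainMidEig_eq_eig_one v x).1]
  rfl

/-- **At a point of `U_s`, every other eigenbasis vector has eigenvalue `≤ λ₂(x)`** (the sorted
eigenvalues are `λ₁ > λ₂ ≥ λ₃`, and only one basis index can carry `λ₁`). [folklore] -/
theorem eigenvalues_le_midEig_of_ne {x : UnitAddTorus (Fin 3)}
    (hx : torusStrainMidEig v x < torusStrainTopEig v x) {a₀ : Fin 3}
    (ha₀ : (torusStrainMatrix_isHermitian v x).eigenvalues a₀ = torusStrainTopEig v x)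
    {a : Fin 3} (ha : a ≠ a₀) :
    (torusStrainMatrix_isHermitian v x).eigenvalues a ≤ torusStrainMidEig v x := by
  set hS := torusStrainMatrix_isHermitian v x
  let e3 : Fin (Fintype.card (Fin 3)) ≃ Fin 3 := Fintype.equivOfCardEq (Fintype.card_fin _)
  have he : ∀ j, hS.eigenvalues (e3 j) = hS.eigenvalues₀ j := fun j => by
    simp [Matrix.IsHermitian.eigenvalues, e3]
  obtain ⟨htop, hmid⟩ := torusStrainMidEig_eq_eig_one v x
  have htop' : torusStrainTopEig v x = hS.eigenvalues₀ (Fin.castLE two_le_card_fin_three' 0) := htop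
  have hmid' : torusStrainMidEig v x = hS.eigenvalues₀ (Fin.castLE two_le_card_fin_three' 1) := hmid
  -- an index `j ≠ castLE 0` has `eigenvalues₀ j ≤ eigenvalues₀ (castLE 1) = λ₂`
  have hkey : ∀ j : Fin (Fintype.card (Fin 3)), j ≠ Fin.castLE two_le_card_fin_three' 0 →
      hS.eigenvalues₀ j ≤ torusStrainMidEig v x := by
    intro j hj
    rw [hmid']
    refine hS.eigenvalues₀_antitone ?_
    have hj' : (j : ℕ) ≠ 0 := fun h => hj (Fin.ext (by simpa using h))
    show (Fin.castLE two_le_card_fin_three' 1 : ℕ) ≤ (j : ℕ)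
    simp only [Fin.val_castLE, Fin.val_one]
    omega
  -- `a = e3 j`; if `j = castLE 0` then `κ a = λ₁`, and then `a₀`'s index is another `λ₁`-index
  obtain ⟨j, rfl⟩ := e3.surjective a
  rw [he]
  by_cases hj : j = Fin.castLE two_le_card_fin_three' 0
  · -- then `a₀ = e3 j₀` with `j₀ ≠ castLE 0` carries `λ₁ ≤ λ₂ < λ₁`: impossible
    exfalso
    obtain ⟨j₀, hj₀⟩ := e3.surjective a₀
    have hne : j₀ ≠ Fin.castLE two_le_card_fin_three' 0 := by
      rintro rfl
      exact ha (by rw [← hj₀, hj])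
    have h1 := hkey j₀ hne
    rw [← he, hj₀, ha₀] at h1
    linarith
  · exact hkey j hj

/-- **THE GAP FORM AT THE TOP EIGENBASIS VECTOR.** At `x ∈ U_s` and a basis index `a₀` with
`κ a₀ = λ₁(x)`: `u₀ := u_{a₀}` is a unit vector with `S(x)u₀ = λ₁(x)u₀` and
`wᵀS(x)w ≤ λ₂(x)|w|² = (λ₁ − (λ₁ − λ₂))|w|²` on `u₀^⊥` (expand `w` in the eigenbasis). [folklore] -/
theorem gapForm_eigenvectorBasis {x : UnitAddTorus (Fin 3)}
    (hx : torusStrainMidEig v x < torusStrainTopEig v x) {a₀ : Fin 3}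
    (ha₀ : (torusStrainMatrix_isHermitian v x).eigenvalues a₀ = torusStrainTopEig v x) :
    ((torusStrainMatrix_isHermitian v x).eigenvectorBasis a₀).ofLp ⬝ᵥ
        ((torusStrainMatrix_isHermitian v x).eigenvectorBasis a₀).ofLp = 1 ∧
      torusStrainMatrix v x *ᵥ ((torusStrainMatrix_isHermitian v x).eigenvectorBasis a₀).ofLp =
        torusStrainTopEig v x • ((torusStrainMatrix_isHermitian v x).eigenvectorBasis a₀).ofLp ∧
      ∀ w, w ⬝ᵥ ((torusStrainMatrix_isHermitian v x).eigenvectorBasis a₀).ofLp = 0 →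
        w ⬝ᵥ torusStrainMatrix v x *ᵥ w ≤
          (torusStrainTopEig v x - (torusStrainTopEig v x - torusStrainMidEig v x)) * (w ⬝ᵥ w) := by
  set hS := torusStrainMatrix_isHermitian v x
  have horth := KyFan.eigenvectorBasis_dotProduct hS
  refine ⟨by rw [horth a₀ a₀, if_pos rfl], by rw [hS.mulVec_eigenvectorBasis a₀, ha₀], fun w hw => ?_⟩
  rw [sub_sub_cancel, KyFan.dotProduct_mulVec_eq_sum_eigen hS w, KyFan.dotProduct_self_eq_sum_sq hS w,
    Finset.mul_sum]
  refine Finset.sum_le_sum fun a _ => ?_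
  by_cases ha : a = a₀
  · subst ha
    have h0 : (hS.eigenvectorBasis a).ofLp ⬝ᵥ w = 0 := by rw [dotProduct_comm]; exact hw
    rw [h0]
    simp
  · exact mul_le_mul_of_nonneg_right (eigenvalues_le_midEig_of_ne hx ha₀ ha) (sq_nonneg _)

/-! ## 2. The channels of `∂ₖ∂ₖλ₁` and `Δλ₁` in the eigenbasis (R-form) -/

/-- **PROP. 3 AT A POINT OF `U_s`, R-FORM IN THE EIGENBASIS.** For `v` smooth on `T³`, `x` with
`λ₂(x) < λ₁(x)`, a basis index `a₀` with `κ a₀ = λ₁(x)` and `u₀ := u_{a₀}`, and a coordinate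
direction `k`:  `∂ₖλ₁(x) = u₀ᵀS(∂ₖv)(x)u₀` and
`∂ₖ∂ₖλ₁(x) = u₀ᵀS(∂ₖ∂ₖv)(x)u₀ + 2∑_{a≠a₀}(u_aᵀS(∂ₖv)(x)u₀)²/(λ₁(x) − κ_a)`.
(The continued eigenpair along the coordinate line, `hasDerivAt_top_eigenpair`, its persistence, and
the frame identity `eigenpair_channel_eq_sum_frame`.) [ours; F1 PART I Prop. 3 / (1)] -/
theorem partialDeriv_partialDeriv_torusStrainTopEig_eq_sum_frame (hv : Torus.IsSmooth v)
    {x : UnitAddTorus (Fin 3)} (hx : torusStrainMidEig v x < torusStrainTopEig v x) {a₀ : Fin 3}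
    (ha₀ : (torusStrainMatrix_isHermitian v x).eigenvalues a₀ = torusStrainTopEig v x) (k : Fin 3) :
    Torus.partialDeriv k (torusStrainTopEig v) x =
        ((torusStrainMatrix_isHermitian v x).eigenvectorBasis a₀).ofLp ⬝ᵥ
          (torusStrainMatrix (Torus.partialDeriv k v) x *ᵥ
            ((torusStrainMatrix_isHermitian v x).eigenvectorBasis a₀).ofLp) ∧
      Torus.partialDeriv k (Torus.partialDeriv k (torusStrainTopEig v)) x =
        ((torusStrainMatrix_isHermitian v x).eigenvectorBasis a₀).ofLp ⬝ᵥ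
            (torusStrainMatrix (Torus.partialDeriv k (Torus.partialDeriv k v)) x *ᵥ
              ((torusStrainMatrix_isHermitian v x).eigenvectorBasis a₀).ofLp) +
          2 * ∑ a ∈ Finset.univ.erase a₀,
            (((torusStrainMatrix_isHermitian v x).eigenvectorBasis a).ofLp ⬝ᵥ
                (torusStrainMatrix (Torus.partialDeriv k v) x *ᵥ
                  ((torusStrainMatrix_isHermitian v x).eigenvectorBasis a₀).ofLp)) ^ 2 /
              (torusStrainTopEig v x - (torusStrainMatrix_isHermitian v x).eigenvalues a) := by
  obtain ⟨he1, hSe, hgap⟩ := gapForm_eigenvectorBasis hx ha₀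
  set e : Fin 3 → ℝ := ((torusStrainMatrix_isHermitian v x).eigenvectorBasis a₀).ofLp with hedef
  have hg : 0 < torusStrainTopEig v x - torusStrainMidEig v x := sub_pos.2 hx
  set K : EuclideanSpace ℝ (Fin 3) := EuclideanSpace.single k (1 : ℝ) with hK
  -- the family along the coordinate line
  set L : ℝ → Matrix (Fin 3) (Fin 3) ℝ := fun t => torusStrainMatrix v (x + proj (t • K)) with hL
  have hLs : ∀ i j, ContDiff ℝ ∞ fun t => L t i j := fun i j =>
    contDiff_coordLine (isSmooth_torusStrainMatrix_entry hv i j) x K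
  have hLsymm : ∀ t, (L t).IsSymm := fun t => torusStrainMatrix_isSymm v _
  have hL0 : L 0 = torusStrainMatrix v x := by simp only [hL, coordLine_zero]
  have hSe' : L 0 *ᵥ e = torusStrainTopEig v x • e := by rw [hL0]; exact hSe
  have hgap' : ∀ w, w ⬝ᵥ e = 0 → w ⬝ᵥ L 0 *ᵥ w ≤
      (torusStrainTopEig v x - (torusStrainTopEig v x - torusStrainMidEig v x)) * (w ⬝ᵥ w) := by
    intro w hw; rw [hL0]; exact hgap w hw
  obtain ⟨N, Λ, hN, hΛ, hN0, hΛ0, hev, hHF, hD2Λ, -, -⟩ :=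
    hasDerivAt_top_eigenpair hLs hLsymm he1 hSe' hg hgap'
  -- the continued eigenvalue IS `λ₁ ∘ L` near `0`
  have hpers := eventually_top_eigenpair hLs hLsymm he1 hSe' hg hgap' hN hΛ hN0 hΛ0 hev
  have heq : (fun θ => lam1 (L θ)) =ᶠ[𝓝 0] Λ := hpers.mono fun θ h => h.1
  have hD1 := hHF.congr_of_eventuallyEq heq
  have heq' : deriv (fun θ => lam1 (L θ)) =ᶠ[𝓝 0] deriv Λ := by
    filter_upwards [heq.eventually_nhds] with θ hθ
    exact Filter.EventuallyEq.deriv_eq (hθ : (fun θ => lam1 (L θ)) =ᶠ[𝓝 θ] Λ)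
  have hD2 := hD2Λ.congr_of_eventuallyEq heq'
  -- entrywise derivatives of `L` at `0`
  have hA : ∀ i j, HasDerivAt (fun t => L t i j) (torusStrainMatrix (Torus.partialDeriv k v) x i j) 0 := by
    intro i j
    have h := hasDerivAt_coordLine (isSmooth_torusStrainMatrix_entry hv i j) x k 0
    rw [coordLine_zero, partialDeriv_strainEntry hv] at h
    exact h
  have hd1 : ∀ i j, deriv (fun t => L t i j) 0 = torusStrainMatrix (Torus.partialDeriv k v) x i j :=
    fun i j => (hA i j).deriv
  have hd1fun : ∀ i j, deriv (fun t => L t i j) =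
      fun t => torusStrainMatrix (Torus.partialDeriv k v) (x + proj (t • K)) i j := by
    intro i j
    funext t
    have h := (hasDerivAt_coordLine (isSmooth_torusStrainMatrix_entry hv i j) x k t).deriv
    rw [partialDeriv_strainEntry hv] at h
    exact h
  have hd2 : ∀ i j, deriv (deriv fun t => L t i j) 0 =
      torusStrainMatrix (Torus.partialDeriv k (Torus.partialDeriv k v)) x i j := by
    intro i j
    rw [hd1fun i j]
    have h := (hasDerivAt_coordLine (isSmooth_torusStrainMatrix_entry (hv.partialDeriv k) i j) x k 0).deriv
    rw [coordLine_zero, partialDeriv_strainEntry (hv.partialDeriv k)] at h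
    exact h
  have hM1 : (Matrix.of fun i j => deriv (fun t => L t i j) 0) =
      torusStrainMatrix (Torus.partialDeriv k v) x := by
    ext i j; rw [Matrix.of_apply, hd1]
  have hM2 : (Matrix.of fun i j => deriv (deriv fun t => L t i j) 0) =
      torusStrainMatrix (Torus.partialDeriv k (Torus.partialDeriv k v)) x := by
    ext i j; rw [Matrix.of_apply, hd2]
  rw [hM1] at hD1
  rw [hM1, hM2] at hD2
  -- `λ₁ ∘ L` is the line function of `torusStrainTopEig`
  have hfun : (fun t => lam1 (L t)) = fun t => torusStrainTopEig v (x + proj (t • K)) := by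
    funext t; exact lam1_torusStrainMatrix v _
  rw [hfun] at hD1 hD2
  have h1 : Torus.partialDeriv k (torusStrainTopEig v) x =
      e ⬝ᵥ (torusStrainMatrix (Torus.partialDeriv k v) x *ᵥ e) := hD1.deriv
  have h2 : Torus.partialDeriv k (Torus.partialDeriv k (torusStrainTopEig v)) x =
      e ⬝ᵥ (torusStrainMatrix (Torus.partialDeriv k (Torus.partialDeriv k v)) x *ᵥ e) +
        2 * ((fun i => deriv (fun t => N t i) 0) ⬝ᵥ
          (torusStrainMatrix (Torus.partialDeriv k v) x *ᵥ e)) := by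
    rw [partialDeriv_partialDeriv_eq_deriv_deriv, ← hK]
    exact hD2.deriv
  -- the frame identity for the channel `N′ᵀ S(∂ₖv) e`
  have hN1 : ContDiffAt ℝ 1 N 0 := hN.of_le (by simp)
  have hNev : ∀ᶠ t in 𝓝 (0 : ℝ), ∀ i, DifferentiableAt ℝ (fun s => N s i) t := by
    filter_upwards [hN1.eventually (by simp)] with t ht
    intro i
    exact (differentiableAt_pi.1 (ht.differentiableAt (by simp))) i
  have hN0' : ∀ i, HasDerivAt (fun t => N t i) (deriv (fun t => N t i) 0) 0 := fun i =>
    (hNev.self_of_nhds i).hasDerivAt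
  have heig : ∀ᶠ θ in 𝓝 (0 : ℝ), L θ *ᵥ N θ = Λ θ • N θ := hev.mono fun θ h => h.1
  have hunit : ∀ᶠ θ in 𝓝 (0 : ℝ), N θ ⬝ᵥ N θ = 1 := hev.mono fun θ h => h.2
  have horth := KyFan.eigenvectorBasis_dotProduct (torusStrainMatrix_isHermitian v x)
  have hu : ∀ a, L 0 *ᵥ ((torusStrainMatrix_isHermitian v x).eigenvectorBasis a).ofLp =
      (torusStrainMatrix_isHermitian v x).eigenvalues a •
        ((torusStrainMatrix_isHermitian v x).eigenvectorBasis a).ofLp := by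
    intro a; rw [hL0]; exact (torusStrainMatrix_isHermitian v x).mulVec_eigenvectorBasis a
  have hu₀ : ((torusStrainMatrix_isHermitian v x).eigenvectorBasis a₀).ofLp = N 0 := by
    rw [hN0]
  have horth' : ∀ a, a ≠ a₀ →
      ((torusStrainMatrix_isHermitian v x).eigenvectorBasis a).ofLp ⬝ᵥ N 0 = 0 := by
    intro a ha
    rw [hN0, hedef, horth a a₀, if_neg ha]
  have hgapκ : ∀ a, a ≠ a₀ → (torusStrainMatrix_isHermitian v x).eigenvalues a ≠ Λ 0 := by
    intro a ha h
    have hle := eigenvalues_le_midEig_of_ne hx ha₀ ha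
    rw [h, hΛ0] at hle
    linarith
  have hspan : ∀ y : Fin 3 → ℝ, y = ∑ a, (y ⬝ᵥ ((torusStrainMatrix_isHermitian v x).eigenvectorBasis a).ofLp) •
      ((torusStrainMatrix_isHermitian v x).eigenvectorBasis a).ofLp := by
    intro y
    have h := KyFan.eq_sum_dotProduct_smul (torusStrainMatrix_isHermitian v x) y
    simp_rw [dotProduct_comm y]
    exact h
  have hframe := eigenpair_channel_eq_sum_frame hA hN0' (hLsymm 0) heig hunit hu hu₀ horth' hgapκ hspan
  -- `hframe : N′ ⬝ᵥ (S(∂ₖv) x *ᵥ N 0) = ∑_{a ≠ a₀} (u a ⬝ᵥ (S(∂ₖv) x *ᵥ N 0))² / (Λ 0 − κ a)`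
  rw [hN0, hΛ0] at hframe
  refine ⟨h1, ?_⟩
  rw [h2, hframe]

/-- **SIEVELD'S DENSITY (1) VERBATIM AT A POINT OF `U_s` — the Laplacian of `λ₁` in the eigenbasis.**
For `v` smooth on `T³`, `x` with `λ₂(x) < λ₁(x)` and a basis index `a₀` with `κ a₀ = λ₁(x)`,
`u₀ := u_{a₀}`:  `Δλ₁(x) = u₀ᵀS(Δv)(x)u₀ + 2∑ₖ∑_{a≠a₀}(u_aᵀS(∂ₖv)(x)u₀)²/(λ₁(x) − κ_a)`,
each denominator `≥ λ₁(x) − λ₂(x) > 0` (`eigenvalues_le_midEig_of_ne`): the rotation (`κ_a = λ₂`) and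
tilt (`κ_a = λ₃`) channels `⟨e_a, ∂ₖS e₁⟩²/(λ₁ − λ_a)` of F1 PART I (1). [ours; F1 PART I Prop. 3 /
Lemma 10 (e)] -/
theorem laplacian_torusStrainTopEig_eq_sum_frame (hv : Torus.IsSmooth v)
    {x : UnitAddTorus (Fin 3)} (hx : torusStrainMidEig v x < torusStrainTopEig v x) {a₀ : Fin 3}
    (ha₀ : (torusStrainMatrix_isHermitian v x).eigenvalues a₀ = torusStrainTopEig v x) :
    Torus.laplacian (torusStrainTopEig v) x =
      ((torusStrainMatrix_isHermitian v x).eigenvectorBasis a₀).ofLp ⬝ᵥ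
          (torusStrainMatrix (Torus.laplacian v) x *ᵥ
            ((torusStrainMatrix_isHermitian v x).eigenvectorBasis a₀).ofLp) +
        2 * ∑ k, ∑ a ∈ Finset.univ.erase a₀,
          (((torusStrainMatrix_isHermitian v x).eigenvectorBasis a).ofLp ⬝ᵥ
              (torusStrainMatrix (Torus.partialDeriv k v) x *ᵥ
                ((torusStrainMatrix_isHermitian v x).eigenvectorBasis a₀).ofLp)) ^ 2 /
            (torusStrainTopEig v x - (torusStrainMatrix_isHermitian v x).eigenvalues a) := by
  obtain ⟨he1, hSe, hgap⟩ := gapForm_eigenvectorBasis hx ha₀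
  have hg : 0 < torusStrainTopEig v x - torusStrainMidEig v x := sub_pos.2 hx
  rw [laplacian_torusStrainTopEig_eq_sum_of_gapForm hv he1 hSe hg hgap]
  have hk := fun k => (partialDeriv_partialDeriv_torusStrainTopEig_eq_sum_frame hv hx ha₀ k).2
  simp_rw [hk]
  set e : Fin 3 → ℝ := ((torusStrainMatrix_isHermitian v x).eigenvectorBasis a₀).ofLp with hedef
  rw [Finset.sum_add_distrib, Finset.mul_sum]
  congr 1
  -- `∑ₖ u₀ᵀ S(∂ₖ∂ₖv) u₀ = u₀ᵀ S(Δv) u₀`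
  calc ∑ k, e ⬝ᵥ (torusStrainMatrix (Torus.partialDeriv k (Torus.partialDeriv k v)) x *ᵥ e)
      = ∑ k, ∑ i, ∑ j, e i * torusStrainMatrix (Torus.partialDeriv k (Torus.partialDeriv k v)) x i j * e j :=
        Finset.sum_congr rfl fun k _ => dotProduct_mulVec_eq_sum_sum _ _ _
    _ = ∑ i, ∑ j, ∑ k, e i * torusStrainMatrix (Torus.partialDeriv k (Torus.partialDeriv k v)) x i j * e j := by
        rw [Finset.sum_comm]
        exact Finset.sum_congr rfl fun i _ => Finset.sum_comm
    _ = ∑ i, ∑ j, e i * torusStrainMatrix (Torus.laplacian v) x i j * e j := by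
        refine Finset.sum_congr rfl fun i _ => Finset.sum_congr rfl fun j _ => ?_
        rw [← torusStrainMatrix_laplacian hv x i j, Finset.mul_sum, Finset.sum_mul]
    _ = e ⬝ᵥ (torusStrainMatrix (Torus.laplacian v) x *ᵥ e) := (dotProduct_mulVec_eq_sum_sum _ _ _).symm

end TopEig

end Summit.NavierStokesRegularity.FunctionalMining

end
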